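import Summits.FinalStateConjecture.FinalStateConjecture.Theorems.ClusterCompletenessAdiabaticMultiKerrILEDTailsCutStationary
import Literature.Geometry.Lorentzian.KerrTimeDerivative

/-!
# Crux `AdiabaticMultiKerrILED` (line `Sketch`) — two facts about the tails-cut wave operator

Helper file for the crux `stmt-FinalStateConjecture-14310`
(`Summit.FinalStateConjecture.FinalStateConjecture.Theses.ClusterCompleteness.AdiabaticMultiKerrILED`),
line `Sketch`, stubs `waveOperator_tailsCut_timeDeriv_eq_zero` and
`waveOperator_tailsCut_eq_schwarzschild` (lead c7, wave 9).

The rest-frame tails-cut Schwarzschild zone is the generalised Kerr–Schild coefficient field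
`G₀ = KerrSchild.inverseMetric (fun y ↦ σ(2 − r(y)/(8M)) · 2H(y)) (Kerr.nullVector 0)`
(`σ = Real.smoothTransition`, `r = Kerr.radius 0`, `H = Kerr.scalarH M 0`). This file proves:

* `fderiv_coeffGradient_basisVector_zero`, `waveOperator_partial_zero_comm` — for ANY coefficient
  field `G` with `∂₀ G^{μν} = 0` and `G ∈ C²`, `Φ ∈ C³` near `x`, the divergence-form wave
  operator commutes with `∂₀`: `□_G (∂₀Φ)(x) = ∂₀ (□_G Φ)(x)` (product rule and the symmetry of
  second derivatives; the argument of `Kerr.coordWave_partial_zero_comm` for a general `G`);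
* `waveOperator_tailsCut_timeDeriv_eq_zero` — **time-derivative commutation**: if `Φ ∈ C³` solves
  `□_{G₀} Φ = 0` at all points `z` with `F(z⃗) ≤ z⁰` and `r(z) > 2M`, then so does `∂₀Φ`
  (`G₀` is stationary, `fderiv_tailsCut_inverseMetric_basisVector_zero`; the region is invariant
  under `t ↦ x + t ∂₀`, `t ≥ 0`, so `t ↦ □Φ(x + t∂₀)` vanishes on `[0, ∞)` and its (existing)
  derivative at `0` vanishes by uniqueness of the one-sided derivative);
* `waveOperator_tailsCut_eq_schwarzschild` — **agreement with exact Schwarzschild inside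
  `{r < 8M}`**: there the cut-off is `1` on a neighbourhood (`tailsCut_profile_eq_of_radius_le`,
  continuity of `r`), so the two coefficient fields agree near `x` and the wave operators agree at
  `x` (`KerrSchild.waveOperator_congr_of_eventuallyEq`).

Kerr–Schild 1965, §2 (stationarity of the Kerr–Schild form); Dafermos–Rodnianski–
Shlapentokh-Rothman arXiv:1402.7034, §2.2.2 (`[□_g, T] = 0` for the Killing field `T = ∂_{t*}`).
[folklore]
-/

noncomputable section

-- the doubled `FinalStateConjecture.FinalStateConjecture` path component trips dupNamespace
set_option linter.dupNamespace false

open scoped ContDiff Topology BigOperators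
open Filter Set Literature.Geometry.Lorentzian

namespace Summit.FinalStateConjecture.FinalStateConjecture.Theorems

/-! ### `∂₀` commutes with the wave operator of a stationary coefficient field -/

/-- **Stationarity of the principal part** for a general coefficient field: if `G^{μν}` is
differentiable at `y` with `∂₀ G^{μν}(y) = 0` and `Φ` is `C²` at `y`, then
`∂₀ (∑_ν G^{μν} ∂_νΦ)(y) = ∑_ν G^{μν}(y) ∂_ν(∂₀Φ)(y)` (product rule and symmetry of second
derivatives). [folklore] -/
theorem fderiv_coeffGradient_basisVector_zero {G : E4 → Fin 4 → Fin 4 → ℝ} {Φ : E4 → ℝ}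
    {y : E4} (hG : ∀ μ ν, DifferentiableAt ℝ (fun z ↦ G z μ ν) y)
    (hG0 : ∀ μ ν, fderiv ℝ (fun z ↦ G z μ ν) y (E4.basisVector 0) = 0)
    (hΦ : ContDiffAt ℝ 2 Φ y) (μ : Fin 4) :
    fderiv ℝ (fun z ↦ ∑ ν, G z μ ν * fderiv ℝ Φ z (E4.basisVector ν)) y (E4.basisVector 0) =
      ∑ ν, G y μ ν * fderiv ℝ (fun z ↦ fderiv ℝ Φ z (E4.basisVector 0)) y (E4.basisVector ν) := by
  have hdg : ∀ ν, HasFDerivAt (fun z ↦ G z μ ν) (fderiv ℝ (fun z ↦ G z μ ν) y) y :=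
    fun ν ↦ (hG μ ν).hasFDerivAt
  have hdΦ : ∀ ν, HasFDerivAt (fun z ↦ fderiv ℝ Φ z (E4.basisVector ν))
      (fderiv ℝ (fun z ↦ fderiv ℝ Φ z (E4.basisVector ν)) y) y := fun ν ↦
    ((contDiffAt_fderiv_apply_const (n := 1) (by exact_mod_cast hΦ) _).differentiableAt
      one_ne_zero).hasFDerivAt
  have hsum := HasFDerivAt.fun_sum fun ν (_ : ν ∈ Finset.univ) ↦ (hdg ν).mul (hdΦ ν)
  rw [show (fun z ↦ ∑ ν, G z μ ν * fderiv ℝ Φ z (E4.basisVector ν)) =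
      fun z ↦ ∑ ν, ((fun z ↦ G z μ ν) * fun z ↦ fderiv ℝ Φ z (E4.basisVector ν)) z
      from rfl, hsum.fderiv]
  simp only [_root_.sum_apply, _root_.add_apply,
    _root_.smul_apply, smul_eq_mul, hG0, mul_zero, add_zero]
  refine Finset.sum_congr rfl fun ν _ ↦ ?_
  rw [fderiv_fderiv_apply_comm hΦ]

/-- The first-order part `z ↦ ∑_ν G^{μν}(z) ∂_νΦ(z)` is `C^n` at a point where `G` is `C^n` and
`Φ` is `C^{n+1}`. [folklore] -/
theorem contDiffAt_coeffGradient {G : E4 → Fin 4 → Fin 4 → ℝ} {Φ : E4 → ℝ} {y : E4} {n : ℕ∞}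
    (hG : ∀ μ ν, ContDiffAt ℝ n (fun z ↦ G z μ ν) y) (hΦ : ContDiffAt ℝ (n + 1) Φ y)
    (μ : Fin 4) :
    ContDiffAt ℝ n (fun z ↦ ∑ ν, G z μ ν * fderiv ℝ Φ z (E4.basisVector ν)) y :=
  ContDiffAt.sum fun ν _ ↦ (hG μ ν).mul (contDiffAt_fderiv_apply_const hΦ _)

/-- **The divergence-form wave operator is differentiable** at a point where the coefficients are
`C²` and the function is `C³`. [folklore] -/
theorem differentiableAt_waveOperator {G : E4 → Fin 4 → Fin 4 → ℝ} {Φ : E4 → ℝ} {x : E4}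
    (hG : ∀ μ ν, ContDiffAt ℝ 2 (fun z ↦ G z μ ν) x) (hΦ : ContDiffAt ℝ 3 Φ x) :
    DifferentiableAt ℝ (fun y ↦ KerrSchild.waveOperator G Φ y) x := by
  have hA2 : ∀ μ, ContDiffAt ℝ 2 (fun z ↦ ∑ ν, G z μ ν * fderiv ℝ Φ z (E4.basisVector ν)) x :=
    fun μ ↦ contDiffAt_coeffGradient hG (by exact_mod_cast hΦ) μ
  unfold KerrSchild.waveOperator
  exact DifferentiableAt.fun_sum fun μ _ ↦
    (contDiffAt_fderiv_apply_const (n := 1) (by exact_mod_cast hA2 μ) _).differentiableAt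
      one_ne_zero

/-- **The divergence-form wave operator of a stationary coefficient field commutes with `∂₀`**:
if, near `x`, `G^{μν}` is `C²` with `∂₀ G^{μν} = 0` and `Φ` is `C³`, then
`□_G (∂₀Φ)(x) = ∂₀ (□_G Φ)(x)` (DRSR arXiv:1402.7034, §2.2.2: `T = ∂_{t*}` is Killing, so
`[□_g, T] = 0`; here by the product rule, `∂₀ G = 0` and the symmetry of second and third
derivatives). [folklore] -/
theorem waveOperator_partial_zero_comm {G : E4 → Fin 4 → Fin 4 → ℝ} {Φ : E4 → ℝ} {x : E4}
    (h : ∀ᶠ y in 𝓝 x, (∀ μ ν, ContDiffAt ℝ 2 (fun z ↦ G z μ ν) y) ∧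
      (∀ μ ν, fderiv ℝ (fun z ↦ G z μ ν) y (E4.basisVector 0) = 0) ∧ ContDiffAt ℝ 3 Φ y) :
    KerrSchild.waveOperator G (fun z ↦ fderiv ℝ Φ z (E4.basisVector 0)) x =
      fderiv ℝ (fun y ↦ KerrSchild.waveOperator G Φ y) x (E4.basisVector 0) := by
  obtain ⟨hGx, -, hΦx⟩ := h.self_of_nhds
  -- abbreviation for the first-order parts
  set A : Fin 4 → E4 → ℝ := fun μ z ↦ ∑ ν, G z μ ν * fderiv ℝ Φ z (E4.basisVector ν) with hA
  -- near `x`, `∑_ν G^{μν} ∂_ν(∂₀Φ) = ∂₀ A_μ`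
  have h2 : ∀ μ, (fun y ↦ ∑ ν, G y μ ν *
      fderiv ℝ (fun z ↦ fderiv ℝ Φ z (E4.basisVector 0)) y (E4.basisVector ν)) =ᶠ[𝓝 x]
      fun y ↦ fderiv ℝ (A μ) y (E4.basisVector 0) := by
    intro μ
    filter_upwards [h] with y hy
    rw [hA]
    exact (fderiv_coeffGradient_basisVector_zero
      (fun μ ν ↦ (hy.1 μ ν).differentiableAt two_ne_zero) hy.2.1
      (hy.2.2.of_le (by norm_num)) μ).symm
  -- `A_μ` is `C²` at `x`
  have hA2 : ∀ μ, ContDiffAt ℝ 2 (A μ) x := fun μ ↦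
    contDiffAt_coeffGradient hGx (n := 2) (by exact_mod_cast hΦx) μ
  -- `∂_μ ∂₀ A_μ = ∂₀ ∂_μ A_μ` at `x`
  have h3 : ∀ μ, fderiv ℝ (fun y ↦ ∑ ν, G y μ ν *
      fderiv ℝ (fun z ↦ fderiv ℝ Φ z (E4.basisVector 0)) y (E4.basisVector ν)) x
        (E4.basisVector μ) =
      fderiv ℝ (fun y ↦ fderiv ℝ (A μ) y (E4.basisVector μ)) x (E4.basisVector 0) := by
    intro μ
    rw [(h2 μ).fderiv_eq, fderiv_fderiv_apply_comm (hA2 μ)]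
  -- sum over `μ`
  have hd : ∀ μ, HasFDerivAt (fun y ↦ fderiv ℝ (A μ) y (E4.basisVector μ))
      (fderiv ℝ (fun y ↦ fderiv ℝ (A μ) y (E4.basisVector μ)) x) x := fun μ ↦
    ((contDiffAt_fderiv_apply_const (n := 1) (by exact_mod_cast hA2 μ) _).differentiableAt
      one_ne_zero).hasFDerivAt
  have hsum := HasFDerivAt.fun_sum fun μ (_ : μ ∈ Finset.univ) ↦ hd μ
  unfold KerrSchild.waveOperator
  simp only [h3]
  rw [hsum.fderiv, _root_.sum_apply]

/-- A function on `ℝ` with a derivative at `0` which vanishes on `[0, ∞)` has derivative `0` there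
(uniqueness of the one-sided derivative within `Ici 0`). [folklore] -/
theorem hasDerivAt_unique_of_eqOn_Ici {g : ℝ → ℝ} {L : ℝ} (hg : HasDerivAt g L 0)
    (h0 : ∀ t, 0 ≤ t → g t = 0) : L = 0 := by
  have h1 : HasDerivWithinAt g L (Ici 0) 0 := hg.hasDerivWithinAt
  have h2 : HasDerivWithinAt g 0 (Ici 0) 0 :=
    (hasDerivWithinAt_const (0 : ℝ) (Ici 0) (0 : ℝ)).congr (fun t ht ↦ h0 t ht) (h0 0 le_rfl)
  exact (uniqueDiffWithinAt_Ici (0 : ℝ)).eq_deriv _ h1 h2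

/-! ### The two facts about the tails-cut wave operator -/

/-- **Time-derivative commutation on the tails-cut zone.** If `Φ ∈ C³` solves `□_{G₀} Φ = 0` at
all points `z` with `F(z⃗) ≤ z⁰` and `r(z) > 2M`, then so does `Φ̇ = ∂₀Φ`: at such an `x` the
function `t ↦ (□_{G₀}Φ)(x + t∂₀)` vanishes for `t ≥ 0` (same spatial part, later time) and is
differentiable at `t = 0` (`G₀ ∈ C^∞` on `{r > 0}`, `Φ ∈ C³`), so `∂₀(□_{G₀}Φ)(x) = 0`, and
`□_{G₀}(∂₀Φ)(x) = ∂₀(□_{G₀}Φ)(x)` because `∂₀ G₀ = 0`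
(`fderiv_tailsCut_inverseMetric_basisVector_zero`, `waveOperator_partial_zero_comm`).
DRSR arXiv:1402.7034, §2.2.2. [folklore] -/
theorem waveOperator_tailsCut_timeDeriv_eq_zero : ∀ (M : ℝ) (F : E3 → ℝ) (Φ : E4 → ℝ) (x : E4), 0 < M → ContDiff ℝ 3 Φ → (∀ z : E4, F (E4.spatial z) ≤ z 0 → 2 * M < Kerr.radius 0 z → KerrSchild.waveOperator (KerrSchild.inverseMetric (fun y ↦ Real.smoothTransition (2 - Kerr.radius 0 y / (8 * M)) * (2 * Kerr.scalarH M 0 y)) (Kerr.nullVector 0)) Φ z = 0) → F (E4.spatial x) ≤ x 0 → 2 * M < Kerr.radius 0 x → KerrSchild.waveOperator (KerrSchild.inverseMetric (fun y ↦ Real.smoothTransition (2 - Kerr.radius 0 y / (8 * M)) * (2 * Kerr.scalarH M 0 y)) (Kerr.nullVector 0)) (fun z ↦ fderiv ℝ Φ z (E4.basisVector 0)) x = 0 := by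
  intro M F Φ x hM hΦ hsol hF hr
  set G : E4 → Fin 4 → Fin 4 → ℝ := KerrSchild.inverseMetric
    (fun y ↦ Real.smoothTransition (2 - Kerr.radius 0 y / (8 * M)) * (2 * Kerr.scalarH M 0 y))
    (Kerr.nullVector 0) with hG
  have hrx : 0 < Kerr.radius 0 x := by linarith
  -- `r > 0` near `x`
  have hnear : ∀ᶠ y in 𝓝 x, 0 < Kerr.radius 0 y :=
    (Kerr.continuous_radius 0).continuousAt.eventually (lt_mem_nhds hrx)
  -- the hypotheses of the commutation lemma hold near `x`
  have hcomm_hyp : ∀ᶠ y in 𝓝 x, (∀ μ ν, ContDiffAt ℝ 2 (fun z ↦ G z μ ν) y) ∧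
      (∀ μ ν, fderiv ℝ (fun z ↦ G z μ ν) y (E4.basisVector 0) = 0) ∧ ContDiffAt ℝ 3 Φ y := by
    filter_upwards [hnear] with y hy
    exact ⟨fun μ ν ↦ contDiffAt_tailsCut_inverseMetric M 0 hy μ ν,
      fun μ ν ↦ fderiv_tailsCut_inverseMetric_basisVector_zero M 0 y μ ν hy, hΦ.contDiffAt⟩
  rw [waveOperator_partial_zero_comm hcomm_hyp]
  -- `□Φ` is differentiable at `x`
  have hdiff : DifferentiableAt ℝ (fun y ↦ KerrSchild.waveOperator G Φ y) x :=
    differentiableAt_waveOperator (fun μ ν ↦ contDiffAt_tailsCut_inverseMetric M 0 hrx μ ν)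
      hΦ.contDiffAt
  -- the line derivative along `∂₀`
  have hline : HasDerivAt (fun t : ℝ ↦ KerrSchild.waveOperator G Φ (x + t • E4.basisVector 0))
      (fderiv ℝ (fun y ↦ KerrSchild.waveOperator G Φ y) x (E4.basisVector 0)) 0 :=
    hdiff.hasFDerivAt.hasLineDerivAt (E4.basisVector 0)
  -- `□Φ (x + t ∂₀) = 0` for `t ≥ 0`
  have hzero : ∀ t : ℝ, 0 ≤ t →
      KerrSchild.waveOperator G Φ (x + t • E4.basisVector 0) = 0 := by
    intro t ht
    refine hsol (x + t • E4.basisVector 0) ?_ ?_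
    · rw [Kerr.spatial_add_smul_basisVector_zero]
      have h0 : (x + t • E4.basisVector 0) 0 = x 0 + t := by simp
      rw [h0]
      linarith
    · rwa [Kerr.radius_add_time_smul_basisVector]
  exact hasDerivAt_unique_of_eqOn_Ici hline hzero

/-- **Agreement with exact Schwarzschild inside `{r < 8M}`.** For `r(x) < 8M` the cut-off factor
`σ(2 − r/(8M))` equals `1` on a neighbourhood of `x` (`{r < 8M}` is open by continuity of `r`;
`tailsCut_profile_eq_of_radius_le`), so the tails-cut coefficient field agrees near `x` with the
exact Schwarzschild Kerr–Schild field `η⁻¹ − 2H ℓ♯ ⊗ ℓ♯`, and the wave operators (which are local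
in the coefficients, `KerrSchild.waveOperator_congr_of_eventuallyEq`) agree at `x`. No positivity
of `r(x)` is needed. [folklore] -/
theorem waveOperator_tailsCut_eq_schwarzschild : ∀ (M : ℝ) (Φ : E4 → ℝ) (x : E4), 0 < M → Kerr.radius 0 x < 8 * M → KerrSchild.waveOperator (KerrSchild.inverseMetric (fun y ↦ Real.smoothTransition (2 - Kerr.radius 0 y / (8 * M)) * (2 * Kerr.scalarH M 0 y)) (Kerr.nullVector 0)) Φ x = KerrSchild.waveOperator (KerrSchild.inverseMetric (fun y ↦ 2 * Kerr.scalarH M 0 y) (Kerr.nullVector 0)) Φ x := by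
  intro M Φ x hM hr
  -- `r < 8M` near `x`
  have hnear : ∀ᶠ y in 𝓝 x, Kerr.radius 0 y < 8 * M :=
    (Kerr.continuous_radius 0).continuousAt.eventually (gt_mem_nhds hr)
  refine KerrSchild.waveOperator_congr_of_eventuallyEq (fun μ ν ↦ ?_) Φ
  filter_upwards [hnear] with y hy
  simp only [KerrSchild.inverseMetric, tailsCut_profile_eq_of_radius_le M 0 y hM hy.le]

end Summit.FinalStateConjecture.FinalStateConjecture.Theorems

end
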